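import Literature.Analysis.FluidPDE.PeriodicLerayProfilePotential
import HarnessLib

/-!
# The gradient-Newtonian potential off the support of the density: kernel-side derivative and
# `|y|⁻³` decay

Analysis/FluidPDE support file (theorems only) for the discharge of the named fact
`Literature.Analysis.FluidPDE.bradshawTsai2017_lemma_2_5` (`PeriodicLerayExistence.lean`;
Bradshaw–Tsai, Ann. Henri Poincaré 18 (2017) = arXiv:1510.07504 [BT1], Lemma 2.5). The printed
proof of the bound "`|∇w(y)| ≤ C(R₀,U₀)/(1+|y|³)`" for the divergence correction
`w = −∫ (∇ξ·U₀)(z) ∇Γ(· − z) dz` reads, for `|y| ≥ 4R₀`: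
"`∇w(y) = ∫ ∇_z∇_y (4π|z−y|)⁻¹ (∇ξ·U₀)(z) dz`, and it follows that
`|∇w(y)| ≤ c R₀^{5/4}‖U₀‖_{L⁴}/|y|³`". This file proves the kernel-side differentiation and the
decay for a continuous density `G` supported in `B̄(0, ρ₀)` and points `|y| ≥ 2ρ₀`:

* `hasFDerivAt_gradient_newtonKernel`, `inner_fderiv_gradient_newtonKernel_apply`,
  `norm_fderiv_gradient_newtonKernel_le`: `∇Γ` is differentiable off the origin with
  `‖D∇Γ(x)‖ ≤ (π|x|³)⁻¹` (from the tree's `|D²Γ(x)(a,b)| ≤ |a||b|/(π|x|³)`);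
* `hasFDerivAt_potential_of_far`: `D(∫ G(z) ∇Γ(· − z) dz)(y) = ∫ G(z) D∇Γ(y − z) dz` for
  `|y| ≥ 2ρ₀` (dominated convergence on `B(y, ρ₀/2)`);
* `norm_fderiv_potential_le_of_far`: `‖D(∫ G(z) ∇Γ(· − z) dz)(y)‖ ≤ 8 (∫|G|) /(π|y|³)`.

## References

* Z. Bradshaw, T.-P. Tsai, Ann. Henri Poincaré 18 (2017) = arXiv:1510.07504, proof of Lemma 2.5
  (the bound on `∇w` for `|y| ≥ 4R₀`) [BradshawTsai2017AHP].
* D. Gilbarg, N. S. Trudinger, *Elliptic partial differential equations of second order*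
  (2001), (2.12)–(2.14), Lemma 4.1. [GilbargTrudinger2001]
-/

noncomputable section

open MeasureTheory Set Filter Topology Function Metric InnerProductSpace
open scoped ENNReal NNReal RealInnerProductSpace

namespace Literature.Analysis.FluidPDE

namespace NewtonGradPotential

/-! ### `∇Γ` off the origin: differentiability and the bound `‖D∇Γ(x)‖ ≤ (π|x|³)⁻¹` -/

/-- `DΓ` is differentiable off the origin. [folklore] -/
theorem differentiableAt_fderiv_newtonKernel {x : EuclideanSpace ℝ (Fin 3)} (hx : x ≠ 0) :
    DifferentiableAt ℝ (fderiv ℝ newtonKernel) x :=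
  ((contDiffAt_newtonKernel hx (n := 2)).fderiv_right (m := 1) le_rfl).differentiableAt one_ne_zero

/-- `∇Γ` is differentiable off the origin. [folklore] -/
theorem hasFDerivAt_gradient_newtonKernel {x : EuclideanSpace ℝ (Fin 3)} (hx : x ≠ 0) :
    HasFDerivAt (gradient newtonKernel) (fderiv ℝ (gradient newtonKernel) x) x := by
  have h : DifferentiableAt ℝ (gradient newtonKernel) x := by
    have e : gradient newtonKernel = fun z =>
        (InnerProductSpace.toDual ℝ (EuclideanSpace ℝ (Fin 3))).symm (fderiv ℝ newtonKernel z) :=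
      rfl
    rw [e]
    exact (InnerProductSpace.toDual ℝ (EuclideanSpace ℝ (Fin 3))).symm.differentiableAt.comp x
      (differentiableAt_fderiv_newtonKernel hx)
  exact h.hasFDerivAt

/-- `⟪D∇Γ(x) v, a⟫ = D²Γ(x)(a; v)`: the derivative of `∇Γ` paired with `a` is the derivative of
`∂ₐΓ`. [folklore] -/
theorem inner_fderiv_gradient_newtonKernel_apply {x : EuclideanSpace ℝ (Fin 3)} (hx : x ≠ 0)
    (v a : EuclideanSpace ℝ (Fin 3)) :
    ⟪fderiv ℝ (gradient newtonKernel) x v, a⟫ =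
      fderiv ℝ (fun w => fderiv ℝ newtonKernel w a) x v := by
  have e : (fun w => fderiv ℝ newtonKernel w a) = fun w => ⟪gradient newtonKernel w, a⟫ :=
    funext fun w => inner_gradient_left.symm
  have h := (hasFDerivAt_gradient_newtonKernel hx).inner ℝ (hasFDerivAt_const a x)
  rw [e, h.fderiv]
  simp [fderivInnerCLM_apply]

/-- **`‖D∇Γ(x) v‖ ≤ |v|/(π|x|³)`** off the origin. [cite: GilbargTrudinger2001, (2.14)] -/
theorem norm_fderiv_gradient_newtonKernel_apply_le {x : EuclideanSpace ℝ (Fin 3)} (hx : x ≠ 0)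
    (v : EuclideanSpace ℝ (Fin 3)) :
    ‖fderiv ℝ (gradient newtonKernel) x v‖ ≤ ‖v‖ / (Real.pi * ‖x‖ ^ 3) := by
  set u := fderiv ℝ (gradient newtonKernel) x v with hu
  have hx' : 0 < ‖x‖ := norm_pos_iff.2 hx
  have h1 : ‖u‖ ^ 2 ≤ ‖u‖ * ‖v‖ / (Real.pi * ‖x‖ ^ 3) := by
    rw [← real_inner_self_eq_norm_sq, hu, inner_fderiv_gradient_newtonKernel_apply hx]
    refine (le_abs_self _).trans ((abs_fderiv_fderiv_newtonKernel_apply_le hx _ _).trans ?_)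
    rfl
  by_cases hu0 : ‖u‖ = 0
  · rw [hu0]; positivity
  · have hupos : 0 < ‖u‖ := lt_of_le_of_ne (norm_nonneg _) (Ne.symm hu0)
    rw [sq, mul_div_assoc] at h1
    exact le_of_mul_le_mul_left h1 hupos

/-- `‖D∇Γ(x)‖ ≤ (π|x|³)⁻¹` off the origin. [cite: GilbargTrudinger2001, (2.14)] -/
theorem norm_fderiv_gradient_newtonKernel_le {x : EuclideanSpace ℝ (Fin 3)} (hx : x ≠ 0) :
    ‖fderiv ℝ (gradient newtonKernel) x‖ ≤ (Real.pi * ‖x‖ ^ 3)⁻¹ := by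
  refine ContinuousLinearMap.opNorm_le_bound _ (by positivity) fun v => ?_
  rw [inv_mul_eq_div]
  exact norm_fderiv_gradient_newtonKernel_apply_le hx v

/-! ### The potential off the support: kernel-side derivative and decay -/

section Far

variable {G : EuclideanSpace ℝ (Fin 3) → ℝ} {ρ₀ : ℝ}

/-- Geometry of the far region: for `|y₀| ≥ 2ρ₀`, `|y − y₀| < ρ₀/2` and `|z| ≤ ρ₀` one has
`|y − z| ≥ ρ₀/2` and `|y₀ − z| ≥ |y₀|/2`. [folklore] -/
theorem norm_sub_ge_of_far {y₀ y z : EuclideanSpace ℝ (Fin 3)}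
    (hy₀ : 2 * ρ₀ ≤ ‖y₀‖) (hy : y ∈ ball y₀ (ρ₀ / 2)) (hz : ‖z‖ ≤ ρ₀) :
    ρ₀ / 2 ≤ ‖y - z‖ := by
  rw [mem_ball, dist_eq_norm] at hy
  have h1 : ‖y₀‖ ≤ ‖y - z‖ + ‖y - y₀‖ + ‖z‖ := by
    calc ‖y₀‖ = ‖(y - z) - (y - y₀) + z‖ := by congr 1; abel
      _ ≤ ‖(y - z) - (y - y₀)‖ + ‖z‖ := norm_add_le _ _
      _ ≤ ‖y - z‖ + ‖y - y₀‖ + ‖z‖ := by linarith [norm_sub_le (y - z) (y - y₀)]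
  linarith

/-- For `|y₀| ≥ 2ρ₀` and `|z| ≤ ρ₀`: `|y₀ − z| ≥ |y₀|/2`, hence
`|y₀ − z|⁻³ ≤ 8|y₀|⁻³`. [folklore] -/
theorem inv_norm_sub_pow_three_le (hρ₀ : 0 < ρ₀) {y₀ z : EuclideanSpace ℝ (Fin 3)}
    (hy₀ : 2 * ρ₀ ≤ ‖y₀‖) (hz : ‖z‖ ≤ ρ₀) :
    (Real.pi * ‖y₀ - z‖ ^ 3)⁻¹ ≤ 8 / (Real.pi * ‖y₀‖ ^ 3) := by
  have hy₀' : 0 < ‖y₀‖ := by linarith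
  have h1 : ‖y₀‖ / 2 ≤ ‖y₀ - z‖ := by
    have := norm_add_le (y₀ - z) z
    rw [sub_add_cancel] at this
    linarith
  have hyz : 0 < ‖y₀ - z‖ := by linarith
  have h2 : (‖y₀‖ / 2) ^ 3 ≤ ‖y₀ - z‖ ^ 3 := by gcongr
  rw [inv_eq_one_div, div_le_div_iff₀ (by positivity) (by positivity)]
  nlinarith [h2, Real.pi_pos]

variable (hG : Continuous G) (hρ₀ : 0 < ρ₀) (hGρ : ∀ z, ρ₀ < ‖z‖ → G z = 0)
include hG hρ₀ hGρ

omit hG hρ₀ in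
/-- A continuous density vanishing off `B̄(0, ρ₀)` has compact support. [folklore] -/
theorem hasCompactSupport_of_eq_zero_off_ball : HasCompactSupport G :=
  HasCompactSupport.intro (isCompact_closedBall (0 : EuclideanSpace ℝ (Fin 3)) ρ₀) fun z hz =>
    hGρ z (by simpa [mem_closedBall_zero_iff] using hz)

/-- **Kernel-side differentiation off the support.** For a continuous density `G` supported in
`B̄(0, ρ₀)` and a point `|y₀| ≥ 2ρ₀`, the potential `y ↦ ∫ G(z) ∇Γ(y − z) dz` has derivative
`∫ G(z) D∇Γ(y₀ − z) dz` at `y₀` ([BT1], proof of Lemma 2.5: "If `|y| ≥ 4R₀` then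
`∇w(y) = ∫ ∇_z∇_y (4π|z−y|)⁻¹ (∇ξ·U₀)(z) dz`"; dominated convergence on `B(y₀, ρ₀/2)`,
where `|y − z| ≥ ρ₀/2` on the support). [cite: BradshawTsai2017AHP, proof of Lemma 2.5] -/
theorem hasFDerivAt_potential_of_far {y₀ : EuclideanSpace ℝ (Fin 3)} (hy₀ : 2 * ρ₀ ≤ ‖y₀‖) :
    HasFDerivAt (fun y => ∫ z, G z • gradient newtonKernel (y - z))
      (∫ z, G z • fderiv ℝ (gradient newtonKernel) (y₀ - z)) y₀ := by
  have hGc : HasCompactSupport G := hasCompactSupport_of_eq_zero_off_ball hGρ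
  -- nonvanishing of `y - z` on the support, for `y` near `y₀`
  have hfar : ∀ y ∈ ball y₀ (ρ₀ / 2), ∀ z, G z ≠ 0 → ρ₀ / 2 ≤ ‖y - z‖ := fun y hy z hz =>
    norm_sub_ge_of_far hy₀ hy (not_lt.1 fun h => hz (hGρ z h))
  have hne : ∀ y ∈ ball y₀ (ρ₀ / 2), ∀ z, G z ≠ 0 → y - z ≠ 0 := by
    intro y hy z hz h
    have := hfar y hy z hz
    rw [h, norm_zero] at this
    linarith
  set bound : EuclideanSpace ℝ (Fin 3) → ℝ := fun z => ‖G z‖ * (Real.pi * (ρ₀ / 2) ^ 3)⁻¹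
    with hbound
  refine hasFDerivAt_integral_of_dominated_of_fderiv_le (μ := volume)
    (F := fun y z => G z • gradient newtonKernel (y - z))
    (F' := fun y z => G z • fderiv ℝ (gradient newtonKernel) (y - z)) (x₀ := y₀)
    (bound := bound) (ball_mem_nhds y₀ (by positivity : (0 : ℝ) < ρ₀ / 2)) ?_ ?_ ?_ ?_ ?_ ?_
  · exact Eventually.of_forall fun y =>
      (integrable_smul_gradient_newtonKernel hG hGc y).aestronglyMeasurable
  · exact integrable_smul_gradient_newtonKernel hG hGc y₀
  · refine (hG.aestronglyMeasurable.smul ?_)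
    exact ((measurable_fderiv ℝ (gradient newtonKernel)).comp
      (measurable_const.sub measurable_id)).aestronglyMeasurable
  · refine Eventually.of_forall fun z y hy => ?_
    by_cases hz : G z = 0
    · rw [hz, zero_smul ℝ (fderiv ℝ (gradient newtonKernel) (y - z)), norm_zero, hbound]
      positivity
    · rw [norm_smul]
      refine mul_le_mul_of_nonneg_left ?_ (norm_nonneg _)
      refine (norm_fderiv_gradient_newtonKernel_le (hne y hy z hz)).trans ?_
      have h2 := hfar y hy z hz
      gcongr
  · exact (hG.norm.mul continuous_const).integrable_of_hasCompactSupport hGc.norm.mul_right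
  · refine Eventually.of_forall fun z y hy => ?_
    by_cases hz : G z = 0
    · rw [hz, zero_smul ℝ (fderiv ℝ (gradient newtonKernel) (y - z))]
      simp only [zero_smul]
      exact hasFDerivAt_const _ _
    · have hd := hasFDerivAt_gradient_newtonKernel (hne y hy z hz)
      have hc : HasFDerivAt (fun y : EuclideanSpace ℝ (Fin 3) => y - z)
          (ContinuousLinearMap.id ℝ _) y := (hasFDerivAt_id y).sub_const z
      have h := (hd.comp y hc).const_smul (G z)
      rw [ContinuousLinearMap.comp_id] at h
      exact h

/-- **The `|y|⁻³` decay of the derivative off the support** ([BT1], proof of Lemma 2.5: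
"`|∇w(y)| ≤ c R₀^{5/4}‖U₀‖_{L⁴}/|y|³`" for `|y| ≥ 4R₀`): for `G` continuous supported in
`B̄(0, ρ₀)` and `|y| ≥ 2ρ₀`,
`‖D(∫ G(z) ∇Γ(· − z) dz)(y)‖ ≤ 8 (∫ |G|)/(π|y|³)` (`‖D∇Γ(y − z)‖ ≤ (π|y−z|³)⁻¹ ≤ 8/(π|y|³)` on
the support). [cite: BradshawTsai2017AHP, proof of Lemma 2.5] -/
theorem norm_fderiv_potential_le_of_far {y : EuclideanSpace ℝ (Fin 3)} (hy : 2 * ρ₀ ≤ ‖y‖) :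
    ‖fderiv ℝ (fun y => ∫ z, G z • gradient newtonKernel (y - z)) y‖ ≤
      8 / (Real.pi * ‖y‖ ^ 3) * ∫ z, |G z| := by
  have hGc : HasCompactSupport G := hasCompactSupport_of_eq_zero_off_ball hGρ
  rw [(hasFDerivAt_potential_of_far hG hρ₀ hGρ hy).fderiv, ← integral_const_mul]
  refine norm_integral_le_of_norm_le ((hG.abs.integrable_of_hasCompactSupport
    hGc.abs).const_mul _) (Eventually.of_forall fun z => ?_)
  by_cases hz : G z = 0
  · rw [hz, zero_smul ℝ (fderiv ℝ (gradient newtonKernel) (y - z)), norm_zero, abs_zero,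
      mul_zero]
  · have hzρ : ‖z‖ ≤ ρ₀ := not_lt.1 fun h => hz (hGρ z h)
    have hne : y - z ≠ 0 := by
      intro h
      have h1 : ‖y‖ / 2 ≤ ‖y - z‖ := by
        have := norm_add_le (y - z) z
        rw [sub_add_cancel] at this
        linarith
      rw [h, norm_zero] at h1
      linarith
    rw [norm_smul, Real.norm_eq_abs, mul_comm]
    exact mul_le_mul_of_nonneg_right
      ((norm_fderiv_gradient_newtonKernel_le hne).trans (inv_norm_sub_pow_three_le hρ₀ hy hzρ))
      (abs_nonneg _)

/-- Directional form of the decay: `‖D(∫ G ∇Γ(· − z))(y) v‖ ≤ 8 (∫|G|) |v|/(π|y|³)`. [cite: BradshawTsai2017AHP, proof of Lemma 2.5] -/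
theorem norm_fderiv_potential_apply_le_of_far {y : EuclideanSpace ℝ (Fin 3)} (hy : 2 * ρ₀ ≤ ‖y‖)
    (v : EuclideanSpace ℝ (Fin 3)) :
    ‖fderiv ℝ (fun y => ∫ z, G z • gradient newtonKernel (y - z)) y v‖ ≤
      8 / (Real.pi * ‖y‖ ^ 3) * (∫ z, |G z|) * ‖v‖ :=
  (ContinuousLinearMap.le_opNorm _ _).trans
    (mul_le_mul_of_nonneg_right (norm_fderiv_potential_le_of_far hG hρ₀ hGρ hy) (norm_nonneg _))

end Far

end NewtonGradPotential

end Literature.Analysis.FluidPDE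

end
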